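import Summits.AtomisticToContinuum.BoseEinsteinCondensation.Theorems.DensityResponse.Negative.PeriodisedWell
import Summits.AtomisticToContinuum.BoseEinsteinCondensation.Theorems.DensityResponse.Negative.ModulatedProductState

/-!
# Negative lemmas for crux `DensityResponse` (stmt-AtomisticToContinuum-9481), IV: diluteness is
# load-bearing

Supports (does not close) stmt-AtomisticToContinuum-9481 (crux `DensityResponse`, route
`BECThomsonPrinciple`, rank 4).  Importable landed copy of the cdisprove seat's standing file
`Cruxes/DensityResponse/Disproof.lean` (generation 2), split by topic; `sorry`-free, standard axioms.
Nothing here asserts a `Theses` decl positively.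

The crux: `∀ v ∀ M ∃ ρ₀ C N₀ ∀ N ≥ N₀ ∀ L (N ≤ ρ₀L³) ∀ n ≠ 0 (k∞ = 2π‖n‖∞/L ≤ M√ρ) ∀ s ≥ 0 ∀ Φ :
E₀^per + s|⟨Σᵢ 2cos k·xᵢ⟩_Φ| ≤ E(Φ) + C s² N/(k∞² + ρa)` (static density response
`χ(k) ≤ 2CN/(k² + ρa)` uniformly down to `k = 2π/L`).

* §6 `DensityResponseWithoutDilute` — the crux with the single hypothesis `N ≤ ρ₀L³` deleted;
  `densityResponse_of_withoutDilute` certifies it implies the crux (so it IS the crux minus one hypothesis).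
* §7 **`densityResponse_false_without_dilute : ¬ DensityResponseWithoutDilute`.**  Witness
  `v = 8·1_{r≤1}` (`a ∈ [½,1]`, the tree's `scatteringLength_squareWell_bounds`), `M = 1`,
  `L = 1/(10368·max(C,1))`, `N = max(N₀,1)`, `n = e₀`, `s = (8/9)(k²+ρa)/(2C)`, `Φ = prodState`;
  the chord fails by `(1024 − 704)N²/L²` (`final_ineq`).  Mechanism: at density `ρ ≫ 1/(aR²)` the
  Bogoliubov stiffness is `ρ·v̂(k)`, not `ρa`; in the extreme `L ≪ R` the gas is free (`χ/N = 2/k²`)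
  while `ρa/k² → ∞`.  Any proof of the crux must use diluteness — it is what makes `8πa` the coupling
  at the window's momenta `k ≤ M√ρ ≪ 1/R`.
* §8 `abs_source_le` (`|⟨Σᵢ2cos k·xᵢ⟩_Φ| ≤ 2N`) and `chord_trivial_large_s` (for `s ≥ 2(k∞²+ρa)/C` the
  chord holds for every `v` and state): the content of the crux is `0 ≤ s ≤ 2(k∞²+ρa)/C`.

Remark for planners (not formalised).  The minimal repair is the hypothesis the crux already carries
(`N ≤ ρ₀L³` together with `N ≥ N₀`, forcing `L ≥ (N₀/ρ₀)^{1/3} ≫ R₀`).  The weaker repair "`2R₀ < L`"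
(nearest-image boxes, no density ceiling) is refuted by the same mechanism: at density `ρ ≫ 1/(aR₀²)`
mean-field theory is accurate and the Bogoliubov stiffness at wavenumber `k` is `ρ·v̂(k)`, which for a
positive-type `v` with `v̂(k) ≪ a/C` on `R₀⁻¹ ≪ k ≤ M√ρ` is far below the crux's `ρa` — a formal proof
would need the positive-type lower bound `E₀ ≥ N²v̂(0)/(2L³) − Nv(0)/2` on the torus.
-/

noncomputable section

open MeasureTheory Set Filter Metric
open scoped ENNReal NNReal BigOperators Classical

namespace Summit.AtomisticToContinuum.BoseEinsteinCondensation.Theorems.DensityResponse.Negative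

open Literature.MathematicalPhysics.QuantumManyBody.BoseGas

/-! ## §6 The crux without the diluteness hypothesis, and its refutation -/

/-- **`DensityResponse` with the diluteness hypothesis `N ≤ ρ₀ L³` deleted** (everything else
verbatim; `ρ₀` survives only in `0 < ρ₀`).  `densityResponse_of_withoutDilute` certifies that this
is the crux minus one hypothesis; `densityResponse_false_without_dilute` refutes it: any proof of
the crux must use diluteness.  (A variant STATEMENT of this file, refuted below — not a literature fact;
deliberately untagged so that it is not relocated.) -/
def DensityResponseWithoutDilute : Prop :=
  ∀ v : ℝ → ℝ≥0∞, IsRepulsiveFiniteRange v → ∀ M : ℝ, 0 < M → ∃ ρ₀ C : ℝ, 0 < ρ₀ ∧ 0 < C ∧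
    ∃ N₀ : ℕ, ∀ N : ℕ, N₀ ≤ N → ∀ L : ℝ, 0 < L → ∀ n : Fin 3 → ℤ, n ≠ 0 →
    2 * Real.pi * ‖(fun j => (n j : ℝ))‖ / L ≤ M * Real.sqrt (N / L ^ 3) → ∀ s : ℝ, 0 ≤ s →
    ∀ Φ : PeriodicTrialState N L,
      periodicGroundStateEnergy v N L + ENNReal.ofReal (s * |∫ X in cellN N L,
        (∑ i, 2 * Real.cos (2 * Real.pi / L * ∑ j, (n j : ℝ) * X i j)) * ‖Φ.ψ X‖ ^ 2|) ≤
      periodicEnergy v Φ + ENNReal.ofReal (C * s ^ 2 * N /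
        ((2 * Real.pi * ‖(fun j => (n j : ℝ))‖ / L) ^ 2 + N / L ^ 3 * (scatteringLength v).toReal))

/-- The deleted hypothesis only weakens: the variant implies the crux. [folklore] -/
theorem densityResponse_of_withoutDilute (h : DensityResponseWithoutDilute) :
    Summit.AtomisticToContinuum.BoseEinsteinCondensation.Theses.BECThomsonPrinciple.DensityResponse := by
  intro v hv M hM
  obtain ⟨ρ₀, C, hρ₀, hC, N₀, H⟩ := h v hv M hM
  exact ⟨ρ₀, C, hρ₀, hC, N₀, fun N hN L hL _ n hn hw s hs Φ => H N hN L hL n hn hw s hs Φ⟩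

/-- The scattering length of the well `8·1_{r ≤ 1}` lies in `[1/2, 1]`. [folklore] -/
theorem scatteringLength_sqWell_eight_one :
    1 / 2 ≤ (scatteringLength (sqWell 8 1)).toReal ∧ (scatteringLength (sqWell 8 1)).toReal ≤ 1 := by
  obtain ⟨h1, h2⟩ := scatteringLength_squareWell_bounds (K := 8) (R := 1) (by norm_num) one_pos
  have hs : Real.sqrt (2 / 8) = 1 / 2 := by
    rw [show (2 : ℝ) / 8 = (1 / 2) ^ 2 by norm_num, Real.sqrt_sq (by norm_num)]
  rw [hs, show (1 : ℝ) - 1 / 2 = 1 / 2 by norm_num] at h1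
  have hfin : scatteringLength (sqWell 8 1) ≠ ⊤ := ne_top_of_le_ne_top ENNReal.ofReal_ne_top h2
  constructor
  · have := ENNReal.toReal_mono hfin h1
    rwa [ENNReal.toReal_ofReal (by norm_num)] at this
  · have := ENNReal.toReal_mono ENNReal.ofReal_ne_top h2
    rwa [ENNReal.toReal_ofReal (by norm_num)] at this

/-- The final real-arithmetic inequality (all physics scaled out: `u = 1/L = 10368 C`). [folklore] -/
theorem final_ineq {N C u a ω P : ℝ} (hN : 1 ≤ N) (hC : 1 ≤ C) (hu : u = 10368 * C)
    (ha : 1 / 2 ≤ a) (hω0 : 0 ≤ ω) (hω : ω ≤ 8) (hP : P ≤ N ^ 2) :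
    3 * N * (2 * Real.pi * u) ^ 2 + P * (8 * ((u + 1) ^ 3 * ω)) +
        (8 / 9) ^ 2 * ((2 * Real.pi * u) ^ 2 + N * u ^ 3 * a) * N / (4 * C) <
      P * (8 * ((u - 1) ^ 3 * ω)) + (8 / 9) ^ 2 * ((2 * Real.pi * u) ^ 2 + N * u ^ 3 * a) * N / (2 * C) := by
  have hπ := Real.pi_le_four
  have hπ0 := Real.pi_pos
  have hC0 : 0 < C := by linarith
  have hu1 : 10368 ≤ u := by nlinarith
  have hu0 : 0 < u := by linarith
  have hN2 : N ≤ N ^ 2 := by nlinarith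
  -- the loss
  have hL1 : 3 * N * (2 * Real.pi * u) ^ 2 ≤ 192 * (N * u ^ 2) := by
    have : Real.pi ^ 2 ≤ 16 := by nlinarith
    nlinarith [mul_nonneg (by linarith : (0:ℝ) ≤ N) (sq_nonneg u)]
  have hL2 : P * (8 * ((u + 1) ^ 3 * ω)) - P * (8 * ((u - 1) ^ 3 * ω)) ≤ 512 * (N ^ 2 * u ^ 2) := by
    have h1 : P * (8 * ((u + 1) ^ 3 * ω)) - P * (8 * ((u - 1) ^ 3 * ω)) = 8 * (P * ω) * (6 * u ^ 2 + 2) := by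
      ring
    rw [h1]
    have h2 : P * ω ≤ N ^ 2 * 8 := mul_le_mul hP hω hω0 (by positivity)
    have h3 : 6 * u ^ 2 + 2 ≤ 8 * u ^ 2 := by nlinarith
    calc 8 * (P * ω) * (6 * u ^ 2 + 2) ≤ 8 * (N ^ 2 * 8) * (8 * u ^ 2) := by
          gcongr
      _ = 512 * (N ^ 2 * u ^ 2) := by ring
  -- the gain
  have hG : 1024 * (N ^ 2 * u ^ 2) ≤
      (8 / 9) ^ 2 * ((2 * Real.pi * u) ^ 2 + N * u ^ 3 * a) * N / (4 * C) := by
    rw [le_div_iff₀ (by positivity)]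
    have h1 : N * u ^ 3 * (1 / 2) ≤ (2 * Real.pi * u) ^ 2 + N * u ^ 3 * a := by
      have : N * u ^ 3 * (1 / 2) ≤ N * u ^ 3 * a := by gcongr
      nlinarith [sq_nonneg (2 * Real.pi * u)]
    have h2 : 1024 * (N ^ 2 * u ^ 2) * (4 * C) = (8 / 9) ^ 2 * (N * u ^ 3 * (1 / 2)) * N * (10368 * C / u) := by
      field_simp
      ring
    rw [h2, ← hu, div_self hu0.ne', mul_one]
    have hN0 : 0 ≤ N := by linarith
    nlinarith [mul_le_mul_of_nonneg_right h1 hN0]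
  have hG2 : (8 / 9) ^ 2 * ((2 * Real.pi * u) ^ 2 + N * u ^ 3 * a) * N / (2 * C) =
      2 * ((8 / 9) ^ 2 * ((2 * Real.pi * u) ^ 2 + N * u ^ 3 * a) * N / (4 * C)) := by
    field_simp
    ring
  have h3 : N * u ^ 2 ≤ N ^ 2 * u ^ 2 := mul_le_mul_of_nonneg_right hN2 (sq_nonneg u)
  have hpos : 0 < N ^ 2 * u ^ 2 := by positivity
  linarith [hL1, hL2, hG, hG2, h3, hpos]


/-! ## §7 Refutation of the undiluted crux -/

/-- **Diluteness `N ≤ ρ₀L³` is load-bearing for `DensityResponse`.**  Witness: the square well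
`v = 8·1_{r ≤ 1}` (scattering length `a ∈ [½, 1]`), `M = 1`, and, given the prover's `C, N₀`, the
box `L = 1/(10368·max(C,1))`, `N = max(N₀,1)` particles, the lowest mode `n = e₀` (inside the window
since `4π²L ≤ 1 ≤ N`), the modulated product state `Φ = ∏ᵢ c(1 + ½cos(2πx_{i,0}/L))` and the
optimal tilt `s = (8/9)(k² + ρa)/(2C)`.  Mechanism: for `L ≪ R` every particle interacts with all
`≈ (4π/3)(R/L)³` images of every other, the periodised potential is constant up to the lattice-point
discrepancy `O((L/R)·mean)` (§1–§2), so `E₀` is known to that accuracy from BELOW (`E₀ ≥ #pairs·inf v^per`,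
no kinetic energy needed) while the gas responds like a FREE gas (`χ/N ≈ 2/k²`); the crux's stiffness
`ρa` in the denominator is then spurious and the chord fails by a factor `≈ ρa/(Ck²) → ∞`.
Any proof of the crux must therefore use `N ≤ ρ₀L³` (with `N ≥ N₀` it forces `L ≥ (N₀/ρ₀)^{1/3} ≫ R`,
nearest-image periodisation and genuinely dilute scattering physics). [folklore] -/
theorem densityResponse_false_without_dilute : ¬ DensityResponseWithoutDilute := by
  intro H
  obtain ⟨ρ₀, C, -, hC, N₀, H⟩ := H (sqWell 8 1) (isRepulsiveFiniteRange_sqWell 8 1) 1 one_pos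
  -- constants: C' = max C 1, u = 1/L = 10368 C', N = max N₀ 1
  obtain ⟨C', hC'1, hCC'⟩ : ∃ C' : ℝ, 1 ≤ C' ∧ C ≤ C' := ⟨max C 1, le_max_right _ _, le_max_left _ _⟩
  have hC'0 : 0 < C' := lt_of_lt_of_le one_pos hC'1
  obtain ⟨u, hu⟩ : ∃ u : ℝ, u = 10368 * C' := ⟨_, rfl⟩
  have hu1 : 10368 ≤ u := by rw [hu]; nlinarith
  have hu0 : 0 < u := by linarith
  have hL : (0 : ℝ) < u⁻¹ := inv_pos.2 hu0
  have hL1 : u⁻¹ ≤ 1 := inv_le_one_of_one_le₀ (by linarith)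
  have hdiv : ∀ z : ℝ, z / u⁻¹ = z * u := fun z => by rw [div_eq_mul_inv, inv_inv]
  have hdiv3 : ∀ z : ℝ, z / u⁻¹ ^ 3 = z * u ^ 3 := fun z => by rw [div_eq_mul_inv, inv_pow, inv_inv]
  obtain ⟨N, hN0, hN1⟩ : ∃ N : ℕ, N₀ ≤ N ∧ 1 ≤ N := ⟨max N₀ 1, le_max_left _ _, le_max_right _ _⟩
  have hN1r : (1 : ℝ) ≤ N := by exact_mod_cast hN1
  obtain ⟨ha1, ha2⟩ := scatteringLength_sqWell_eight_one
  -- the lowest mode `n = e₀`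
  obtain ⟨n, hn_def⟩ : ∃ n : Fin 3 → ℤ, n = Pi.single 0 1 := ⟨_, rfl⟩
  have hn : n ≠ 0 := by
    intro h; have := congr_fun h 0; simp [hn_def] at this
  have hnorm : ‖(fun j => (n j : ℝ))‖ = 1 := by
    have : (fun j => (n j : ℝ)) = Pi.single (0 : Fin 3) (1 : ℝ) := by
      funext j; simp only [hn_def, Pi.single_apply]; split_ifs <;> simp
    rw [this, Pi.norm_single, norm_one]
  have hphase : ∀ x : Space, 2 * Real.pi / u⁻¹ * ∑ j, (n j : ℝ) * x j = θL u⁻¹ x := by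
    intro x; simp [hn_def, Pi.single_apply, θL]
  -- the denominator `D = k² + ρa` and the tilt `s`
  obtain ⟨D, hD⟩ : ∃ D : ℝ, D = (2 * Real.pi * u) ^ 2 + N * u ^ 3 * (scatteringLength (sqWell 8 1)).toReal :=
    ⟨_, rfl⟩
  have hD0 : 0 < D := by rw [hD]; positivity
  obtain ⟨s, hs_def⟩ : ∃ s : ℝ, s = 8 / 9 * D / (2 * C') := ⟨_, rfl⟩
  have hs : 0 ≤ s := by rw [hs_def]; positivity
  -- the window: `2π/L ≤ √(N/L³)` since `4π² ≤ u ≤ N u`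
  have hwin : 2 * Real.pi * ‖(fun j => (n j : ℝ))‖ / u⁻¹ ≤ 1 * Real.sqrt (N / u⁻¹ ^ 3) := by
    rw [hnorm, mul_one, one_mul, hdiv, hdiv3]
    apply Real.le_sqrt_of_sq_le
    have hπ := Real.pi_le_four
    have hπ0 := Real.pi_pos
    have hπ2 : Real.pi ^ 2 ≤ 16 := by nlinarith
    have h1 : (2 * Real.pi * u) ^ 2 ≤ 64 * u ^ 2 := by
      nlinarith [mul_le_mul_of_nonneg_right hπ2 (sq_nonneg u)]
    have h2 : 64 * u ^ 2 ≤ (N : ℝ) * u ^ 3 := by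
      have : (64 : ℝ) * 1 ≤ u * N := mul_le_mul (by linarith) hN1r (by norm_num) hu0.le
      nlinarith [sq_nonneg u]
    linarith
  -- apply the undiluted crux to the product state
  have key := H N hN0 u⁻¹ hL n hn hwin s hs (prodState N hL)
  have hsrc : ∫ X in cellN N u⁻¹, (∑ i, 2 * Real.cos (2 * Real.pi / u⁻¹ * ∑ j, (n j : ℝ) * X i j)) *
      ‖(prodState N hL).ψ X‖ ^ 2 = N * (8 / 9) := by
    simp_rw [hphase]; exact source_prodState N hL
  have hden : (2 * Real.pi * ‖(fun j => (n j : ℝ))‖ / u⁻¹) ^ 2 +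
      N / u⁻¹ ^ 3 * (scatteringLength (sqWell 8 1)).toReal = D := by
    rw [hnorm, mul_one, hdiv, hdiv3, hD]
  rw [hsrc, hden, abs_of_nonneg (by positivity)] at key
  -- enlarge the constant to `C'`
  have key' : periodicGroundStateEnergy (sqWell 8 1) N u⁻¹ + ENNReal.ofReal (s * (N * (8 / 9))) ≤
      periodicEnergy (sqWell 8 1) (prodState N hL) + ENNReal.ofReal (C' * s ^ 2 * N / D) :=
    key.trans (add_le_add le_rfl (ENNReal.ofReal_le_ofReal
      (div_le_div_of_nonneg_right (show C * s ^ 2 * N ≤ C' * s ^ 2 * N by gcongr) hD0.le)))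
  -- the squeeze of the periodised well: `m₋ ≤ v^per ≤ m₊`
  have hlow : ∀ y, ENNReal.ofReal (8 * ((u - 1) ^ 3 * ω₃)) ≤ periodizedPotential (sqWell 8 1) u⁻¹ y := by
    intro y
    have := le_periodizedPotential_sqWell (K := 8) (R := 1) (by norm_num) hL hL1 y
    rwa [hdiv, one_mul] at this
  have hupp : ∀ y, periodizedPotential (sqWell 8 1) u⁻¹ y ≤ ENNReal.ofReal (8 * ((u + 1) ^ 3 * ω₃)) := by
    intro y
    have := periodizedPotential_sqWell_le (K := 8) (R := 1) (by norm_num) zero_le_one hL y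
    rwa [hdiv, one_mul] at this
  -- `E₀ ≥ P m₋` and `E(Φ) ≤ T + P m₊`
  have hω0 := ω₃_nonneg
  have hm0 : 0 ≤ 8 * ((u - 1) ^ 3 * ω₃) := by
    have : 0 ≤ u - 1 := by linarith
    positivity
  have hE0 : ENNReal.ofReal ((pairCount N : ℝ) * (8 * ((u - 1) ^ 3 * ω₃))) ≤
      periodicGroundStateEnergy (sqWell 8 1) N u⁻¹ := by
    rw [ENNReal.ofReal_mul (Nat.cast_nonneg _), ENNReal.ofReal_natCast]
    exact le_periodicGroundStateEnergy_of_le ENNReal.ofReal_ne_top hlow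
  have hEΦ : periodicEnergy (sqWell 8 1) (prodState N hL) ≤
      ENNReal.ofReal (3 * N * (2 * Real.pi * u) ^ 2 + (pairCount N : ℝ) * (8 * ((u + 1) ^ 3 * ω₃))) := by
    have h := periodicEnergy_le_of_pointwise (v := sqWell 8 1) (prodState N hL) ENNReal.ofReal_ne_top
      ENNReal.ofReal_ne_top (kineticDensity_prodState_le N hL) hupp
    rw [hdiv] at h
    refine h.trans (le_of_eq ?_)
    rw [ENNReal.ofReal_add (by positivity) (by positivity), ENNReal.ofReal_mul (Nat.cast_nonneg _),
      ENNReal.ofReal_natCast]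
  -- collect everything into one real inequality
  have hcomb : ENNReal.ofReal ((pairCount N : ℝ) * (8 * ((u - 1) ^ 3 * ω₃)) + s * (N * (8 / 9))) ≤
      ENNReal.ofReal (3 * N * (2 * Real.pi * u) ^ 2 + (pairCount N : ℝ) * (8 * ((u + 1) ^ 3 * ω₃)) +
        C' * s ^ 2 * N / D) := by
    rw [ENNReal.ofReal_add (by positivity) (by positivity),
      ENNReal.ofReal_add (by positivity) (by positivity)]
    exact ((add_le_add hE0 le_rfl).trans key').trans (add_le_add hEΦ le_rfl)
  have hreal := (ENNReal.ofReal_le_ofReal_iff (by positivity)).1 hcomb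
  -- the two closed forms of the tilt terms
  have hs1 : s * (N * (8 / 9)) = (8 / 9) ^ 2 * D * N / (2 * C') := by
    rw [hs_def]; field_simp
  have hs2 : C' * s ^ 2 * N / D = (8 / 9) ^ 2 * D * N / (4 * C') := by
    rw [hs_def]; field_simp; ring
  rw [hs1, hs2, hD] at hreal
  have hP : (pairCount N : ℝ) ≤ (N : ℝ) ^ 2 := by exact_mod_cast pairCount_le N
  exact absurd hreal (not_le.2 (final_ineq hN1r hC'1 hu ha1 hω0 ω₃_le_eight hP))


/-! ## §8 Chord structure (re-derived from generation 1): `|⟨V_k⟩| ≤ 2N`, large `s` is trivial -/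

/-- A periodic trial state has Bochner-integrable `|Ψ|²` on the cell, with integral `1`. [folklore] -/
theorem integrableOn_cellN_norm_sq {N : ℕ} {L : ℝ} (Φ : PeriodicTrialState N L) :
    IntegrableOn (fun X => ‖Φ.ψ X‖ ^ 2) (cellN N L) := by
  have hc : Continuous fun X => ‖Φ.ψ X‖ ^ 2 := by exact Φ.contDiff.continuous.norm.pow 2
  refine ⟨hc.aestronglyMeasurable, ?_⟩
  rw [HasFiniteIntegral]
  have h : ∀ X, ‖‖Φ.ψ X‖ ^ 2‖ₑ = (‖Φ.ψ X‖₊ : ℝ≥0∞) ^ 2 := by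
    intro X
    rw [Real.enorm_eq_ofReal (sq_nonneg _), ← ennnorm_sq_eq]
  simp_rw [h]
  rw [Φ.norm_eq]
  exact ENNReal.one_lt_top

/-- `∫_{cellN} |Ψ|² = 1` (Bochner form of the normalisation). [folklore] -/
theorem integral_cellN_norm_sq {N : ℕ} {L : ℝ} (Φ : PeriodicTrialState N L) :
    ∫ X in cellN N L, ‖Φ.ψ X‖ ^ 2 = 1 := by
  have hc : Continuous fun X => ‖Φ.ψ X‖ ^ 2 := by exact Φ.contDiff.continuous.norm.pow 2
  rw [integral_eq_lintegral_of_nonneg_ae (f := fun X => ‖Φ.ψ X‖ ^ 2) (ae_of_all _ fun X => by positivity)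
    hc.aestronglyMeasurable]
  simp_rw [← ennnorm_sq_eq]
  rw [Φ.norm_eq, ENNReal.toReal_one]

/-- **`|⟨Σᵢ 2cos(k·xᵢ)⟩_Φ| ≤ 2N`** for every periodic trial state and every mode. [folklore] -/
theorem abs_source_le {N : ℕ} {L : ℝ} (Φ : PeriodicTrialState N L) (n : Fin 3 → ℤ) :
    |∫ X in cellN N L, (∑ i, 2 * Real.cos (2 * Real.pi / L * ∑ j, (n j : ℝ) * X i j)) * ‖Φ.ψ X‖ ^ 2| ≤
      2 * N := by
  have hg := integrableOn_cellN_norm_sq Φ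
  have hpt : ∀ X : Config N,
      |(∑ i, 2 * Real.cos (2 * Real.pi / L * ∑ j, (n j : ℝ) * X i j)) * ‖Φ.ψ X‖ ^ 2| ≤
        2 * N * ‖Φ.ψ X‖ ^ 2 := by
    intro X
    rw [abs_mul, abs_of_nonneg (sq_nonneg ‖Φ.ψ X‖)]
    refine mul_le_mul_of_nonneg_right ?_ (sq_nonneg _)
    calc |∑ i, 2 * Real.cos (2 * Real.pi / L * ∑ j, (n j : ℝ) * X i j)|
        ≤ ∑ i, |2 * Real.cos (2 * Real.pi / L * ∑ j, (n j : ℝ) * X i j)| := Finset.abs_sum_le_sum_abs _ _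
      _ ≤ ∑ _i : Fin N, (2 : ℝ) := Finset.sum_le_sum fun i _ => by
          rw [abs_mul, abs_two]
          have := Real.abs_cos_le_one (2 * Real.pi / L * ∑ j, (n j : ℝ) * X i j)
          linarith
      _ = 2 * N := by simp [mul_comm]
  calc |∫ X in cellN N L, (∑ i, 2 * Real.cos (2 * Real.pi / L * ∑ j, (n j : ℝ) * X i j)) * ‖Φ.ψ X‖ ^ 2|
      ≤ ∫ X in cellN N L, |(∑ i, 2 * Real.cos (2 * Real.pi / L * ∑ j, (n j : ℝ) * X i j)) * ‖Φ.ψ X‖ ^ 2| :=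
        abs_integral_le_integral_abs
    _ ≤ ∫ X in cellN N L, 2 * N * ‖Φ.ψ X‖ ^ 2 :=
        integral_mono_of_nonneg (ae_of_all _ fun X => abs_nonneg _) (hg.const_mul _) (ae_of_all _ hpt)
    _ = 2 * N := by rw [integral_const_mul, integral_cellN_norm_sq, mul_one]

/-- The window's wavenumber is positive: `0 < 2π‖n‖/L` for `n ≠ 0`. [folklore] -/
theorem kinf_pos {L : ℝ} (hL : 0 < L) {n : Fin 3 → ℤ} (hn : n ≠ 0) :
    0 < 2 * Real.pi * ‖(fun j => (n j : ℝ))‖ / L := by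
  have : (fun j => (n j : ℝ)) ≠ 0 := by
    intro h
    apply hn
    funext j
    have h' : (n j : ℝ) = 0 := congr_fun h j
    exact_mod_cast h'
  have hpos := norm_pos_iff.2 this
  positivity

/-- **For `s ≥ 2(k∞² + ρa)/C` the chord holds trivially, for EVERY `v` and every state** (`E₀ ≤ E(Φ)`
and `s·|⟨V⟩| ≤ 2sN ≤ Cs²N/(k∞² + ρa)`): the content of the crux is `0 ≤ s ≤ 2(k∞² + ρa)/C`.
[folklore] -/
theorem chord_trivial_large_s {N : ℕ} {L : ℝ} (hL : 0 < L) (v : ℝ → ℝ≥0∞) (Φ : PeriodicTrialState N L)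
    {n : Fin 3 → ℤ} (hn : n ≠ 0) {C s : ℝ} (hC : 0 < C)
    (hs : 2 * ((2 * Real.pi * ‖(fun j => (n j : ℝ))‖ / L) ^ 2 +
      N / L ^ 3 * (scatteringLength v).toReal) / C ≤ s) :
    periodicGroundStateEnergy v N L + ENNReal.ofReal (s * |∫ X in cellN N L,
        (∑ i, 2 * Real.cos (2 * Real.pi / L * ∑ j, (n j : ℝ) * X i j)) * ‖Φ.ψ X‖ ^ 2|) ≤
      periodicEnergy v Φ + ENNReal.ofReal (C * s ^ 2 * N /
        ((2 * Real.pi * ‖(fun j => (n j : ℝ))‖ / L) ^ 2 + N / L ^ 3 * (scatteringLength v).toReal)) := by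
  have hk := kinf_pos hL hn
  have hD : 0 < (2 * Real.pi * ‖(fun j => (n j : ℝ))‖ / L) ^ 2 + N / L ^ 3 * (scatteringLength v).toReal := by
    have : 0 ≤ (N : ℝ) / L ^ 3 * (scatteringLength v).toReal := by positivity
    positivity
  have hs0 : 0 ≤ s := le_trans (by positivity) hs
  refine add_le_add (periodicGroundStateEnergy_le v Φ) (ENNReal.ofReal_le_ofReal ?_)
  calc s * |∫ X in cellN N L, (∑ i, 2 * Real.cos (2 * Real.pi / L * ∑ j, (n j : ℝ) * X i j)) * ‖Φ.ψ X‖ ^ 2|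
      ≤ s * (2 * N) := mul_le_mul_of_nonneg_left (abs_source_le Φ n) hs0
    _ ≤ C * s ^ 2 * N /
        ((2 * Real.pi * ‖(fun j => (n j : ℝ))‖ / L) ^ 2 + N / L ^ 3 * (scatteringLength v).toReal) := by
        rw [le_div_iff₀ hD]
        rw [div_le_iff₀ hC] at hs
        have hN : (0 : ℝ) ≤ N := Nat.cast_nonneg _
        nlinarith [mul_nonneg hN hs0]

end Summit.AtomisticToContinuum.BoseEinsteinCondensation.Theorems.DensityResponse.Negative

end
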